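import Summits.ResolutionOfSingularities.ResolutionOfSingularities.Theses.WildQuotients
import Summits.ResolutionOfSingularities.ResolutionOfSingularities.Theses.PAlteration
import Summits.ResolutionOfSingularities.ResolutionOfSingularities.Theorems.PAlterationAssembly2
import Summits.ResolutionOfSingularities.ResolutionOfSingularities.Theorems.PAlterationPicoverToRadicialBottom
import HarnessLib

/-!
# `WildQuotients.Assembly` (stmt-ResolutionOfSingularities-15647) — PROVED

Route `ResolutionOfSingularities/WildQuotients`, item `Assembly` (rank 1):

  `WildQuotientResolution → GaloisReduction → Picover → ResolutionOfSingularities`.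

Pure logic over the PROVED per-prime frame of the sibling route `pAlteration`:
`GaloisReduction := WildQuotientResolution → Pialt`, so the first two hypotheses give `Pialt`
(purely inseparable regular alterations, for every prime), whose body is verbatim the first
conjunct of `PAlteration.PalterationThesis`; `Picover` is verbatim its second conjunct. The
by-name assembly frame `Theorems.assembly2_proof : PAlteration.Assembly2`
(`PalterationThesis → PicoverToRadicialBottom → DescentReducedToIntegral → summit`) is fed with
the two remaining hypotheses discharged in tree: `Theorems.picoverToRadicialBottom_proof`
(stmt-0556) and `PAlteration.DescentReducedToIntegral_holds` (stmt-0551).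
-/

-- single-problem summit: the doubled namespace component `ResolutionOfSingularities` is forced
set_option linter.dupNamespace false

namespace Summit.ResolutionOfSingularities.ResolutionOfSingularities.Theorems

/-- **`WildQuotients.Assembly` holds** (stmt-ResolutionOfSingularities-15647): resolution of
Galois-type quotients of regular schemes (`WildQuotientResolution`), the de Jong reduction
`GaloisReduction : WildQuotientResolution → Pialt` and resolution of finite radicial covers of
regular varieties (`Picover`) together imply the summit statement `ResolutionOfSingularities`.
Proof: `Pialt ∧ Picover` is pAlteration's thesis prime by prime; conclude by the proved frame
`assembly2_proof` with `picoverToRadicialBottom_proof` and `DescentReducedToIntegral_holds`.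
[folklore] -/
theorem wildQuotients_assembly_proof :
    Summit.ResolutionOfSingularities.ResolutionOfSingularities.Theses.WildQuotients.Assembly := by
  unfold Theses.WildQuotients.Assembly
  intro hWQ hGR hPc
  have hPi : Theses.WildQuotients.Pialt := hGR hWQ
  exact assembly2_proof (fun p hp => ⟨hPi p hp, hPc p hp⟩) picoverToRadicialBottom_proof
    Theses.PAlteration.DescentReducedToIntegral_holds

end Summit.ResolutionOfSingularities.ResolutionOfSingularities.Theorems
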